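import Literature.NumberTheory.Automorphic.UnitaryGroupTruncatedKernelClassDifference
import Literature.NumberTheory.Automorphic.UnitaryGroupTruncatedKernelClassMeasurable
import Literature.NumberTheory.Automorphic.UnitaryGroupTruncatedTraceDifferenceUnfolding
import HarnessLib

/-!
# `J^{T'}_𝔬(f) − J^{T}_𝔬(f)` unfolded to the group, class by class: the four nonnegative parts of the class
# window `1_{T<H≤T'} K_{B,𝔬}` integrated against a covering weight of `B(F)` (the per-class Bochner ⇄ lintegral
# bridge of the `𝔬`-expansion road)
(Rogawski, *Automorphic Representations of Unitary Groups in Three Variables* (1990), §2.2 p. 13 and §2.3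
p. 14; Arthur, *The trace formula in invariant form*, Ann. of Math. 114 (1981), Prop. 2.3 — stated class by
class; Gelbart, *Automorphic forms on adele groups* (1975), §9.B (9.40)–(9.48): the unfolding
`∫_{G_ℚ \ G_𝔸} Σ_{B_ℚ \ G_ℚ} φ(δ x) dx = ∫_{B_ℚ \ G_𝔸} φ`)

Topic `NumberTheory/Automorphic`; namespace `Literature.NumberTheory.Automorphic.UnitaryGroup`. THEOREMS
ONLY over accepted tree modules: no definition, no named fact, no `sorry`, no instance, no notation.
Brick (L3-uℂ𝔬) of the road to the per-class polynomiality «`J^T_𝔬(f)` is a polynomial in `log T` of degree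
`≤ 1`, class by class» (the `𝔬`-expansion, Rogawski (1990) §2.3). It is the CLASS COPY of ★
`UnitaryGroupTruncatedTraceDifferenceUnfolding` (`exists_truncatedTrace_sub_eq_parts`): with the CLASS WINDOW
`window_𝔬(y) = 1_{T < H(y) ≤ T'} K_{B,𝔬}(y, y)` (★ `UnitaryGroupTruncatedKernelClassDifference` letters, no
definition) and its four nonnegative parts `w₁ = (Re window_𝔬)⁺`, `w₂ = (Re window_𝔬)⁻`, `w₃ = (Im window_𝔬)⁺`,
`w₄ = (Im window_𝔬)⁻` (written `ENNReal.ofReal (±(window_𝔬 y).re∕im)`),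

  `J^{T'}_𝔬(f) − J^{T}_𝔬(f) = [(C ∫⁻ β w₁).toReal − (C ∫⁻ β w₂).toReal] + i [(C ∫⁻ β w₃).toReal − (C ∫⁻ β w₄).toReal]`

for every continuous `f` (no support condition), every class map `cl` with Rogawski's two partition axioms,
EVERY index `i`, every covering weight `β` of `B(F)♯ ≤ G(𝔸_F)`, every `1 ≤ T ≤ T'` at which `k^T_𝔬`, `k^{T'}_𝔬` are integrable (law 3 (a)), with ONE
constant `C ≠ ∞` (Weil's, from ★ L2-u) for all classes and all windows, each `∫⁻_{G(𝔸)} β w_j dν_G` finite.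

* §1 POINTWISE `ofReal (±re∕im (pseudoEisenstein window_𝔬 y)) = Σ'_q w_j(q̃ y)`
  (`ofReal_comp_pseudoEisenstein_classWindow_eq_tsum`, over ★ `pseudoEisenstein_classWindow_eq_self ∕ _eq_zero ∕
  _rational_mul` and the class-agnostic collapse lemmas ★ `tsum_borelQuotient_eq_of_lt ∕ _eq_zero`), granted the
  left `B(F)`-invariance `hK` of the diagonal of `K_{B,𝔬}`.
* §2 **`exists_truncatedTraceClass_sub_eq_parts`** — THE PER-CLASS BRIDGE (`D = quotFun k^{T'}_𝔬 − quotFun k^{T}_𝔬`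
  is `μ`-integrable; `∫ D = ∫ Re D + i ∫ Im D`; `∫ Re D = (∫⁻ (Re D)⁺).toReal − (∫⁻ (Re D)⁻).toReal`; pointwise
  `D(x) = pseudoEisenstein window_𝔬 (x̃⁻¹)` by ★ `truncatedKernelClass_sub_truncatedKernelClass`, whose `hK` is ★
  `kernelBorelClass_diag_rational_borel_mul hcl hclN`; §1; ★ L2-u
  `exists_ne_zero_lintegral_tsum_borelQuotient_eq_mul_lintegral`, whose `C ≠ 0` turns the finiteness of
  `∫⁻_X (Re D)^± dμ` into that of `∫⁻_G β w_j dν_G`); and its fixed-class corollary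
  `exists_truncatedTraceClass_sub_eq_parts'` in the hypothesis shape of the per-class polynomiality assembly.

## References

* J. D. Rogawski, *Automorphic Representations of Unitary Groups in Three Variables*, Annals of
  Mathematics Studies 123 (1990), §2.2 (p. 13), §2.3 (p. 14) [Rogawski1990].
* J. Arthur, *The trace formula in invariant form*, Ann. of Math. 114 (1981), Prop. 2.3
  [Arthur1981TraceFormulaInvariantForm].
* S. Gelbart, *Automorphic forms on adele groups*, Annals of Mathematics Studies 83 (1975), §9.B
  [Gelbart1975].
-/

set_option autoImplicit false

noncomputable section

open MeasureTheory Measure NumberField IsDedekindDomain Set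
open Literature.MeasureTheory.Group
open scoped NNReal ENNReal Pointwise

namespace Literature.NumberTheory.Automorphic

namespace UnitaryGroup

variable {F E : Type} [Field F] [NumberField F] [Field E] [NumberField E] [Algebra F E]
  {c : E ≃ₐ[F] E} {ι : Type*}

/-! ## §1 The four parts of the class window and their coset sums -/

section Window

variable [MeasurableSpace (adelicUnipotent F E c 3)]

/-- **POINTWISE, CLASS BY CLASS: the clipped real∕imaginary parts of the class window's pseudo-Eisenstein
series are the coset sums of the clipped parts of the class window.** For `1 ≤ T ≤ T'`, every `y`, every
map `φ : ℂ → ℝ` with `φ 0 = 0` (meant: `φ ∈ {re, −re, im, −im}`), and every class map `cl`, index `i`, granted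
the left `B(F)`-invariance `hK` of the diagonal of `K_{B,𝔬}` (★ `kernelBorelClass_diag_rational_borel_mul`):
`ofReal (φ (pseudoEisenstein window_𝔬 y)) = Σ'_{q ∈ B(F)\G(F)} ofReal (φ (window_𝔬 (q̃ y)))` — above the
threshold both sides are the value at the unique class of `B(F)\G(F)` above `T` (★
`pseudoEisenstein_classWindow_eq_self`, ★ `tsum_borelQuotient_eq_of_lt`), below it both vanish (★
`pseudoEisenstein_classWindow_eq_zero`, ★ `tsum_borelQuotient_eq_zero`). Every `ν`, every `𝓕`. The class
analogue of ★ `ofReal_comp_pseudoEisenstein_window_eq_tsum`. [cite: Rogawski1990, §2.2 (p. 13)] -/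
theorem ofReal_comp_pseudoEisenstein_classWindow_eq_tsum {ν : Measure (adelicUnipotent F E c 3)}
    {𝓕 : Set (adelicUnipotent F E c 3)} {cl : (quasiSplit F E c 3).arithmeticSubgroup → ι} {i : ι}
    {f : (quasiSplit F E c 3).Adelic → ℂ}
    (hK : ∀ b ∈ arithmeticBorel F E c 3, ∀ y : (quasiSplit F E c 3).Adelic,
      kernelBorelClass ν 𝓕 cl i f ((b : (quasiSplit F E c 3).Adelic) * y)
        ((b : (quasiSplit F E c 3).Adelic) * y) = kernelBorelClass ν 𝓕 cl i f y y)
    {T T' : ℝ≥0} (hT : 1 ≤ T) (hTT' : T ≤ T')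
    (φ : ℂ → ℝ) (hφ : φ 0 = 0) (y : (quasiSplit F E c 3).Adelic) :
    ENNReal.ofReal (φ (pseudoEisenstein
        ({y : (quasiSplit F E c 3).Adelic | T < borelHeight y ∧ borelHeight y ≤ T'}.indicator
          (fun y => kernelBorelClass ν 𝓕 cl i f y y)) y)) =
      ∑' q : Quotient (QuotientGroup.rightRel (arithmeticBorel F E c 3)),
        ENNReal.ofReal (φ ({y : (quasiSplit F E c 3).Adelic | T < borelHeight y ∧ borelHeight y ≤ T'}.indicator
          (fun y => kernelBorelClass ν 𝓕 cl i f y y)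
            (((q.out : (quasiSplit F E c 3).arithmeticSubgroup) : (quasiSplit F E c 3).Adelic) * y))) := by
  set W : (quasiSplit F E c 3).Adelic → ℂ :=
    {y : (quasiSplit F E c 3).Adelic | T < borelHeight y ∧ borelHeight y ≤ T'}.indicator
      (fun y => kernelBorelClass ν 𝓕 cl i f y y) with hW
  -- the part `ψ = ofReal ∘ φ ∘ W` is left-`B(F)`-invariant and vanishes off `{T < H}`
  have hψB : ∀ b ∈ arithmeticBorel F E c 3, ∀ z : (quasiSplit F E c 3).Adelic,
      ENNReal.ofReal (φ (W ((b : (quasiSplit F E c 3).Adelic) * z))) = ENNReal.ofReal (φ (W z)) := by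
    intro b hb z
    rw [hW, classWindow_rational_borel_mul hK hTT' b hb z]
  have hψT : ∀ z : (quasiSplit F E c 3).Adelic, ¬T < borelHeight z → ENNReal.ofReal (φ (W z)) = 0 := by
    intro z hz
    rw [hW, classWindow_of_not_lt ν 𝓕 cl i f hz, hφ, ENNReal.ofReal_zero]
  by_cases h : ∃ γ : (quasiSplit F E c 3).arithmeticSubgroup,
      T < borelHeight ((γ : (quasiSplit F E c 3).Adelic) * y)
  · obtain ⟨γ, hγ⟩ := h
    rw [tsum_borelQuotient_eq_of_lt hψB hT hψT hγ, hW,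
      ← pseudoEisenstein_classWindow_rational_mul hK hTT' γ y,
      pseudoEisenstein_classWindow_eq_self hK hT hTT' hγ]
  · simp only [not_exists, not_lt] at h
    rw [tsum_borelQuotient_eq_zero hψT h, hW, pseudoEisenstein_classWindow_eq_zero ν 𝓕 cl i f h, hφ,
      ENNReal.ofReal_zero]

end Window

/-! ## §2 The bridge, class by class -/

section Bridge

variable [MeasurableSpace (adelicUnipotent F E c 3)] [BorelSpace (adelicUnipotent F E c 3)]
  [MeasurableSpace (quasiSplit F E c 3).Adelic] [BorelSpace (quasiSplit F E c 3).Adelic]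

/-- **`J^{T'}_𝔬(f) − J^{T}_𝔬(f)` AS FOUR UNFOLDED NONNEGATIVE INTEGRALS, WITH ONE CONSTANT FOR ALL CLASSES AND
ALL WINDOWS.** For a Haar measure `ν` of `N(𝔸_F)`, a fundamental domain `𝓕` of `N(F)`, an automorphic measure `μ`
on `G(F)\G(𝔸_F)`, an inversion-invariant Haar measure `ν_G` of `G(𝔸_F) = U(J₃)(𝔸_F)`, a continuous `f` (no
support condition is needed here), a class map `cl` satisfying Rogawski's two partition axioms (`hcl : IsConjInvariant cl`,
`hclN : IsUnipotentInvariantOnBorel F E c 3 cl` — e.g. the characteristic-polynomial class map, ★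
`isConjInvariant_charpoly_adelicVal`, ★ `isUnipotentInvariantOnBorel_charpoly_adelicVal`) and a covering weight
`β` of `B(F)♯`, there is ONE constant `C ≠ ∞` (Weil's unfolding constant of ★
`exists_ne_zero_lintegral_tsum_borelQuotient_eq_mul_lintegral`, independent of the class) such that for every
index `i` and all `1 ≤ T ≤ T'` at which `k^T_𝔬` and `k^{T'}_𝔬` are integrable over `G(F)\G(𝔸_F)`: the four
integrals `∫⁻_{G(𝔸)} β w_j dν_G` of the parts `w₁ = (Re window_𝔬)⁺, w₂ = (Re window_𝔬)⁻, w₃ = (Im window_𝔬)⁺,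
w₄ = (Im window_𝔬)⁻` of the class window `window_𝔬(y) = 1_{T<H(y)≤T'} K_{B,𝔬}(y, y)` are finite, and
`J^{T'}_𝔬(f) − J^{T}_𝔬(f) = [(C∫⁻βw₁).toReal − (C∫⁻βw₂).toReal] + i[(C∫⁻βw₃).toReal − (C∫⁻βw₄).toReal]`
(`D = quotFun k^{T'}_𝔬 − quotFun k^{T}_𝔬` is `μ`-integrable; `∫ D = ∫ Re D + i ∫ Im D`; positive and negative
parts; `quotFun` is evaluation at `x̃⁻¹`; ★ `truncatedKernelClass_sub_truncatedKernelClass` with `hK` := ★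
`kernelBorelClass_diag_rational_borel_mul hcl hclN`; §1; ★ L2-u with `C ≠ 0`). The class analogue of ★
`exists_truncatedTrace_sub_eq_parts` (Arthur (1981), Prop. 2.3, is stated class by class; Rogawski (1990), §2.3).
[cite: Rogawski1990, §2.3 (p. 14)] [cite: Arthur1981TraceFormulaInvariantForm, Prop. 2.3] -/
theorem exists_truncatedTraceClass_sub_eq_parts (ν : Measure (adelicUnipotent F E c 3)) [ν.IsHaarMeasure]
    {𝓕 : Set (adelicUnipotent F E c 3)} (h𝓕 : IsFundamentalDomain (rationalUnipotent F E c 3) 𝓕 ν)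
    (μ : Measure (quasiSplit F E c 3).automorphicQuotient) [(quasiSplit F E c 3).IsAutomorphicMeasure μ]
    (νG : Measure (quasiSplit F E c 3).Adelic) [νG.IsHaarMeasure] [νG.IsInvInvariant]
    (f : (quasiSplit F E c 3).Adelic → ℂ) (hfc : Continuous f)
    {cl : (quasiSplit F E c 3).arithmeticSubgroup → ι}
    (hcl : IsConjInvariant cl) (hclN : IsUnipotentInvariantOnBorel F E c 3 cl)
    {β : (quasiSplit F E c 3).Adelic → ℝ≥0∞}
    (hβ : IsCoveringWeight ((arithmeticBorel F E c 3).map (quasiSplit F E c 3).arithmeticSubgroup.subtype) β) :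
    ∃ C : ℝ≥0∞, C ≠ ⊤ ∧ ∀ (i : ι) (T T' : ℝ≥0), 1 ≤ T → T ≤ T' →
      Integrable ((quasiSplit F E c 3).quotFun (truncatedKernelClass ν 𝓕 T cl i f)) μ →
      Integrable ((quasiSplit F E c 3).quotFun (truncatedKernelClass ν 𝓕 T' cl i f)) μ →
      (∫⁻ y, β y * ENNReal.ofReal
          ({y : (quasiSplit F E c 3).Adelic | T < borelHeight y ∧ borelHeight y ≤ T'}.indicator
            (fun y => kernelBorelClass ν 𝓕 cl i f y y) y).re ∂νG ≠ ⊤ ∧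
       ∫⁻ y, β y * ENNReal.ofReal
          (-({y : (quasiSplit F E c 3).Adelic | T < borelHeight y ∧ borelHeight y ≤ T'}.indicator
            (fun y => kernelBorelClass ν 𝓕 cl i f y y) y).re) ∂νG ≠ ⊤ ∧
       ∫⁻ y, β y * ENNReal.ofReal
          ({y : (quasiSplit F E c 3).Adelic | T < borelHeight y ∧ borelHeight y ≤ T'}.indicator
            (fun y => kernelBorelClass ν 𝓕 cl i f y y) y).im ∂νG ≠ ⊤ ∧
       ∫⁻ y, β y * ENNReal.ofReal
          (-({y : (quasiSplit F E c 3).Adelic | T < borelHeight y ∧ borelHeight y ≤ T'}.indicator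
            (fun y => kernelBorelClass ν 𝓕 cl i f y y) y).im) ∂νG ≠ ⊤) ∧
      truncatedTraceClass μ ν 𝓕 T' cl i f - truncatedTraceClass μ ν 𝓕 T cl i f =
        (((C * ∫⁻ y, β y * ENNReal.ofReal
            ({y : (quasiSplit F E c 3).Adelic | T < borelHeight y ∧ borelHeight y ≤ T'}.indicator
              (fun y => kernelBorelClass ν 𝓕 cl i f y y) y).re ∂νG).toReal -
          (C * ∫⁻ y, β y * ENNReal.ofReal
            (-({y : (quasiSplit F E c 3).Adelic | T < borelHeight y ∧ borelHeight y ≤ T'}.indicator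
              (fun y => kernelBorelClass ν 𝓕 cl i f y y) y).re) ∂νG).toReal : ℝ) : ℂ) +
        (((C * ∫⁻ y, β y * ENNReal.ofReal
            ({y : (quasiSplit F E c 3).Adelic | T < borelHeight y ∧ borelHeight y ≤ T'}.indicator
              (fun y => kernelBorelClass ν 𝓕 cl i f y y) y).im ∂νG).toReal -
          (C * ∫⁻ y, β y * ENNReal.ofReal
            (-({y : (quasiSplit F E c 3).Adelic | T < borelHeight y ∧ borelHeight y ≤ T'}.indicator
              (fun y => kernelBorelClass ν 𝓕 cl i f y y) y).im) ∂νG).toReal : ℝ) : ℂ) * Complex.I := by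
  classical
  -- `N(𝔸_F)` closed ⇒ second countable, locally compact; `ν` s-finite (for measurability of `K_B`)
  haveI := secondCountableTopology_adeleRing E
  haveI := locallyCompactSpace_adeleRing' E
  haveI := t2Space_adeleRing_of_numberField E
  haveI : T2Space (quasiSplit F E c 3).Adelic :=
    inferInstanceAs (T2Space (adelic F E c 3 ((StdForm.antidiagonal 3).over E)))
  haveI : LocallyCompactSpace (quasiSplit F E c 3).Adelic :=
    inferInstanceAs (LocallyCompactSpace (adelic F E c 3 ((StdForm.antidiagonal 3).over E)))
  haveI : SecondCountableTopology (quasiSplit F E c 3).Adelic :=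
    inferInstanceAs (SecondCountableTopology (adelic F E c 3 ((StdForm.antidiagonal 3).over E)))
  have hNcl : IsClosed ((adelicUnipotent F E c 3 : Set (quasiSplit F E c 3).Adelic)) := by
    change IsClosed (⇑(adelicVal F E c 3 ((StdForm.antidiagonal 3).over E)) ⁻¹'
      ((upperUnitriangular (Fin 3) (AdeleRing (𝓞 E) E) : Subgroup (GL (Fin 3) (AdeleRing (𝓞 E) E))) :
        Set (GL (Fin 3) (AdeleRing (𝓞 E) E))))
    exact (isClosed_upperUnitriangular (R := AdeleRing (𝓞 E) E)).preimage continuous_subtype_val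
  haveI : SecondCountableTopology (adelicUnipotent F E c 3) := TopologicalSpace.Subtype.secondCountableTopology _
  haveI : LocallyCompactSpace (adelicUnipotent F E c 3) := hNcl.locallyCompactSpace
  haveI : SFinite ν := inferInstance
  -- the unfolding constant `C ≠ 0, ≠ ∞` of ★ L2-u
  obtain ⟨C, hC0, hCtop, hunf⟩ :=
    exists_ne_zero_lintegral_tsum_borelQuotient_eq_mul_lintegral (F := F) (E := E) (c := c) μ νG
  refine ⟨C, hCtop, fun i T T' hT hTT' hint hint' => ?_⟩
  -- the `B(F)`-invariance of the diagonal of `K_{B,𝔬}` (Rogawski's two partition axioms)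
  have hK : ∀ b ∈ arithmeticBorel F E c 3, ∀ y : (quasiSplit F E c 3).Adelic,
      kernelBorelClass ν 𝓕 cl i f ((b : (quasiSplit F E c 3).Adelic) * y)
        ((b : (quasiSplit F E c 3).Adelic) * y) = kernelBorelClass ν 𝓕 cl i f y y :=
    fun b hb y => kernelBorelClass_diag_rational_borel_mul hcl hclN ν h𝓕 i f b hb y
  -- the window and its measurability
  set W : (quasiSplit F E c 3).Adelic → ℂ :=
    {y : (quasiSplit F E c 3).Adelic | T < borelHeight y ∧ borelHeight y ≤ T'}.indicator
      (fun y => kernelBorelClass ν 𝓕 cl i f y y) with hW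
  have hWm : Measurable W := by
    refine (measurable_kernelBorelClass_diag hfc ν 𝓕 cl i).indicator ?_
    have h1 := measurableSet_setOf_lt_borelHeight (F := F) (E := E) (c := c) (N := 3) T
    have h2 := measurableSet_setOf_lt_borelHeight (F := F) (E := E) (c := c) (N := 3) T'
    have hset : {y : (quasiSplit F E c 3).Adelic | T < borelHeight y ∧ borelHeight y ≤ T'} =
        {y : (quasiSplit F E c 3).Adelic | T < borelHeight y} \ {y | T' < borelHeight y} := by
      ext y
      simp only [Set.mem_setOf_eq, Set.mem_sdiff, not_lt]
    rw [hset]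
    exact h1.diff h2
  -- the four parts `ψφ = ofReal ∘ φ ∘ W`, `φ ∈ {re, −re, im, −im}`: measurable and `B(F)`-invariant
  have hpart : ∀ φ : ℂ → ℝ, Measurable φ → φ 0 = 0 →
      Measurable (fun y => ENNReal.ofReal (φ (W y))) ∧
      (∀ b ∈ arithmeticBorel F E c 3, ∀ z : (quasiSplit F E c 3).Adelic,
        ENNReal.ofReal (φ (W ((b : (quasiSplit F E c 3).Adelic) * z))) = ENNReal.ofReal (φ (W z))) := by
    intro φ hφm hφ0
    refine ⟨ENNReal.measurable_ofReal.comp (hφm.comp hWm), fun b hb z => ?_⟩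
    rw [hW, classWindow_rational_borel_mul hK hTT' b hb z]
  -- the unfolded identity for one part: `∫⁻_X ofReal (φ (D x)) dμ = C ∫⁻ β ψφ`, where `D(x) = Ψ_W(x̃⁻¹)`
  set D : (quasiSplit F E c 3).automorphicQuotient → ℂ := fun x =>
    (quasiSplit F E c 3).quotFun (truncatedKernelClass ν 𝓕 T' cl i f) x -
      (quasiSplit F E c 3).quotFun (truncatedKernelClass ν 𝓕 T cl i f) x with hD
  have hDW : ∀ x : (quasiSplit F E c 3).automorphicQuotient,
      D x = pseudoEisenstein W ((Quotient.out x : (quasiSplit F E c 3).Adelic)⁻¹) := fun x =>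
    truncatedKernelClass_sub_truncatedKernelClass hcl hK hT hTT' _
  have hDint : Integrable D μ := hint'.sub hint
  have hlin : ∀ φ : ℂ → ℝ, Measurable φ → φ 0 = 0 →
      ∫⁻ x, ENNReal.ofReal (φ (D x)) ∂μ = C * ∫⁻ y, β y * ENNReal.ofReal (φ (W y)) ∂νG := by
    intro φ hφm hφ0
    obtain ⟨hψm, hψB⟩ := hpart φ hφm hφ0
    rw [← hunf β hβ _ hψm hψB]
    refine lintegral_congr fun x => ?_
    rw [hDW x, hW]
    exact ofReal_comp_pseudoEisenstein_classWindow_eq_tsum hK hT hTT' φ hφ0 _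
  -- finiteness: `C ∫⁻ β ψφ = ∫⁻_X ofReal (φ D) ≤ ∫⁻_X ‖D‖ₑ < ∞`, and `C ≠ 0`
  have hfin : ∀ φ : ℂ → ℝ, Measurable φ → φ 0 = 0 → (∀ z : ℂ, φ z ≤ ‖z‖) →
      ∫⁻ y, β y * ENNReal.ofReal (φ (W y)) ∂νG ≠ ⊤ := by
    intro φ hφm hφ0 hφle
    have hle : C * ∫⁻ y, β y * ENNReal.ofReal (φ (W y)) ∂νG ≤ ∫⁻ x, ‖D x‖ₑ ∂μ := by
      rw [← hlin φ hφm hφ0]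
      refine lintegral_mono fun x => ?_
      rw [← ofReal_norm]
      exact ENNReal.ofReal_le_ofReal (hφle _)
    exact (ENNReal.lt_top_of_mul_ne_top_right (ne_top_of_le_ne_top hDint.2.ne hle) hC0).ne
  -- the four `φ`
  have hre0 : (fun z : ℂ => z.re) 0 = 0 := Complex.zero_re
  have hnre0 : (fun z : ℂ => -z.re) 0 = 0 := by simp
  have him0 : (fun z : ℂ => z.im) 0 = 0 := Complex.zero_im
  have hnim0 : (fun z : ℂ => -z.im) 0 = 0 := by simp
  have hrem : Measurable fun z : ℂ => z.re := Complex.measurable_re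
  have hnrem : Measurable fun z : ℂ => -z.re := Complex.measurable_re.neg
  have himm : Measurable fun z : ℂ => z.im := Complex.measurable_im
  have hnimm : Measurable fun z : ℂ => -z.im := Complex.measurable_im.neg
  have hrele : ∀ z : ℂ, (fun z : ℂ => z.re) z ≤ ‖z‖ := fun z => Complex.re_le_norm z
  have hnrele : ∀ z : ℂ, (fun z : ℂ => -z.re) z ≤ ‖z‖ := fun z =>
    (neg_le_abs _).trans (Complex.abs_re_le_norm z)
  have himle : ∀ z : ℂ, (fun z : ℂ => z.im) z ≤ ‖z‖ := fun z => Complex.im_le_norm z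
  have hnimle : ∀ z : ℂ, (fun z : ℂ => -z.im) z ≤ ‖z‖ := fun z =>
    (neg_le_abs _).trans (Complex.abs_im_le_norm z)
  refine ⟨⟨hfin _ hrem hre0 hrele, hfin _ hnrem hnre0 hnrele, hfin _ himm him0 himle,
    hfin _ hnimm hnim0 hnimle⟩, ?_⟩
  -- the Bochner side
  have hsub : truncatedTraceClass μ ν 𝓕 T' cl i f - truncatedTraceClass μ ν 𝓕 T cl i f = ∫ x, D x ∂μ := by
    rw [truncatedTraceClass_def, truncatedTraceClass_def, ← integral_sub hint' hint]
  have hreint : ∫ x, (D x).re ∂μ =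
      (C * ∫⁻ y, β y * ENNReal.ofReal (W y).re ∂νG).toReal -
        (C * ∫⁻ y, β y * ENNReal.ofReal (-(W y).re) ∂νG).toReal := by
    have h := integral_eq_lintegral_pos_part_sub_lintegral_neg_part hDint.re
    simp only [RCLike.re_to_complex] at h
    rw [h]
    change (∫⁻ x, ENNReal.ofReal ((fun z : ℂ => z.re) (D x)) ∂μ).toReal -
        (∫⁻ x, ENNReal.ofReal ((fun z : ℂ => -z.re) (D x)) ∂μ).toReal = _
    rw [hlin _ hrem hre0, hlin _ hnrem hnre0]
  have himint : ∫ x, (D x).im ∂μ =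
      (C * ∫⁻ y, β y * ENNReal.ofReal (W y).im ∂νG).toReal -
        (C * ∫⁻ y, β y * ENNReal.ofReal (-(W y).im) ∂νG).toReal := by
    have h := integral_eq_lintegral_pos_part_sub_lintegral_neg_part hDint.im
    simp only [RCLike.im_to_complex] at h
    rw [h]
    change (∫⁻ x, ENNReal.ofReal ((fun z : ℂ => z.im) (D x)) ∂μ).toReal -
        (∫⁻ x, ENNReal.ofReal ((fun z : ℂ => -z.im) (D x)) ∂μ).toReal = _
    rw [hlin _ himm him0, hlin _ hnimm hnim0]
  rw [hsub, ← integral_re_add_im hDint]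
  simp only [RCLike.re_to_complex, RCLike.im_to_complex, RCLike.I_to_complex]
  rw [hreint, himint]
  rfl

/-- **The fixed-class form** of ★ `exists_truncatedTraceClass_sub_eq_parts` (the identity alone, `cl` and `i`
first, `𝓕` and `β` explicit) — the shape in which the per-class polynomiality assembly consumes it.
[cite: Rogawski1990, §2.3 (p. 14)] [cite: Arthur1981TraceFormulaInvariantForm, Prop. 2.3] -/
theorem exists_truncatedTraceClass_sub_eq_parts' {cl : (quasiSplit F E c 3).arithmeticSubgroup → ι}
    (hcl : IsConjInvariant cl) (hclN : IsUnipotentInvariantOnBorel F E c 3 cl) (i : ι)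
    (ν : Measure (adelicUnipotent F E c 3)) [ν.IsHaarMeasure] (𝓕 : Set (adelicUnipotent F E c 3))
    (h𝓕 : IsFundamentalDomain (rationalUnipotent F E c 3) 𝓕 ν)
    (μ : Measure (quasiSplit F E c 3).automorphicQuotient) [(quasiSplit F E c 3).IsAutomorphicMeasure μ]
    (νG : Measure (quasiSplit F E c 3).Adelic) [νG.IsHaarMeasure] [νG.IsInvInvariant]
    (f : (quasiSplit F E c 3).Adelic → ℂ) (hfc : Continuous f)
    (β : (quasiSplit F E c 3).Adelic → ℝ≥0∞)
    (hβ : IsCoveringWeight ((arithmeticBorel F E c 3).map (quasiSplit F E c 3).arithmeticSubgroup.subtype) β) :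
    ∃ C : ℝ≥0∞, C ≠ ⊤ ∧ ∀ T T' : ℝ≥0, 1 ≤ T → T ≤ T' →
      Integrable ((quasiSplit F E c 3).quotFun (truncatedKernelClass ν 𝓕 T cl i f)) μ →
      Integrable ((quasiSplit F E c 3).quotFun (truncatedKernelClass ν 𝓕 T' cl i f)) μ →
      truncatedTraceClass μ ν 𝓕 T' cl i f - truncatedTraceClass μ ν 𝓕 T cl i f =
        (((C * ∫⁻ y, β y * ENNReal.ofReal
            ({y : (quasiSplit F E c 3).Adelic | T < borelHeight y ∧ borelHeight y ≤ T'}.indicator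
              (fun y => kernelBorelClass ν 𝓕 cl i f y y) y).re ∂νG).toReal -
          (C * ∫⁻ y, β y * ENNReal.ofReal
            (-({y : (quasiSplit F E c 3).Adelic | T < borelHeight y ∧ borelHeight y ≤ T'}.indicator
              (fun y => kernelBorelClass ν 𝓕 cl i f y y) y).re) ∂νG).toReal : ℝ) : ℂ) +
        (((C * ∫⁻ y, β y * ENNReal.ofReal
            ({y : (quasiSplit F E c 3).Adelic | T < borelHeight y ∧ borelHeight y ≤ T'}.indicator
              (fun y => kernelBorelClass ν 𝓕 cl i f y y) y).im ∂νG).toReal -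
          (C * ∫⁻ y, β y * ENNReal.ofReal
            (-({y : (quasiSplit F E c 3).Adelic | T < borelHeight y ∧ borelHeight y ≤ T'}.indicator
              (fun y => kernelBorelClass ν 𝓕 cl i f y y) y).im) ∂νG).toReal : ℝ) : ℂ) * Complex.I := by
  obtain ⟨C, hC, h⟩ := exists_truncatedTraceClass_sub_eq_parts ν h𝓕 μ νG f hfc hcl hclN hβ
  exact ⟨C, hC, fun T T' hT hTT' hint hint' => (h i T T' hT hTT' hint hint').2⟩

end Bridge

end UnitaryGroup

end Literature.NumberTheory.Automorphic
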